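import Mathlib
import HarnessLib
import Summits.QuantumAdvantage.QuantumAdvantage.Theorems.DominoLawC

/-!
# The DOMINO LAW, part D: the full domino law (lens 4 g26, node 4)

Part D.  §10 THE DOMINO LAW `domino_law` (every field with `2 ≠ 0`): if the fixed firing set `Y` fires `3K ≥ 6D + 3` cuts of
`[1, n − 1]` pairwise `≥ 3` apart, then `Y` wins on `{f ≠ 0}` for no non-zero `f` of degree `≤ D` — ball lemma at the designed centre,
`≥ K − D` clean triples (`card_dirty_le`), two active intact dominoes per clean triple (`two_mul_card_clean_le`), the slice law on the
domino cube through the near point.  Corollary `levelSet_empty_of_dense` (perfect strategies, `p` odd).  Supports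
stmt-QuantumAdvantage-28487 (record).
-/

set_option autoImplicit false
set_option linter.dupNamespace false

namespace Summit.QuantumAdvantage.QuantumAdvantage.Theorems.DominoLaw
open Classical
open Finset
open Summit.QuantumAdvantage.AdviceFreeQNC0
open Summit.QuantumAdvantage.AdviceFreeQNC0.JLinPeel
open Summit.QuantumAdvantage.QuantumAdvantage.Theorems.PhaseParity
open Summit.QuantumAdvantage.QuantumAdvantage.Theorems.GapLaw
open Literature.Computability.MetaComplexity Literature.Computability.MetaComplexity.Smolensky

noncomputable section

/-! ### §10 THE DOMINO LAW: `6D + 3` separated fired cuts win on no non-zero set of degree `≤ D` -/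

section FullLaw

variable {n K : ℕ} (h : Fin (3 * K) → ℕ) (hlo : ∀ j, 1 ≤ h j) (hhi : ∀ j, h j + 1 ≤ n)
  (hsep : ∀ j j' : Fin (3 * K), j < j' → h j + 3 ≤ h j')

/-- the `r`-th domino of triple `t'` (`r ≤ 2`). -/
def idxN (t' : Fin K) (r : ℕ) (hr : r ≤ 2) : Fin (3 * K) := ⟨3 * t'.val + r, by have := t'.isLt; omega⟩

/-- its index. -/
theorem idxN_val (t' : Fin K) (r : ℕ) (hr : r ≤ 2) : (idxN t' r hr).val = 3 * t'.val + r := rfl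

/-- the first domino of triple `t'`. -/
def idx0 (t' : Fin K) : Fin (3 * K) := idxN t' 0 (Nat.zero_le 2)

/-- the last domino of triple `t'`. -/
def idx2 (t' : Fin K) : Fin (3 * K) := idxN t' 2 le_rfl

/-- its index. -/
theorem idx0_val (t' : Fin K) : (idx0 t').val = 3 * t'.val := rfl

/-- its index. -/
theorem idx2_val (t' : Fin K) : (idx2 t').val = 3 * t'.val + 2 := rfl

/-- domino `j` (positions `h_j − 1, h_j`) is INTACT in `u`: oriented `(1, 0)` as in the centre. -/
def Intact (u : Fin n → Bool) (j : Fin (3 * K)) : Prop :=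
  u ⟨h j - 1, by have := hhi j; omega⟩ = true ∧ u ⟨h j, by have := hhi j; omega⟩ = false

/-- triple `t'` is CLEAN for `u`: `u` agrees with the centre on the triple's span `[h_{3t'} − 1, h_{3t'+2}]`. -/
def Clean (u : Fin n → Bool) (t' : Fin K) : Prop :=
  ∀ t : Fin n, h (idx0 t') - 1 ≤ t.val → t.val ≤ h (idx2 t') → u t = ctr h t

/-- the ACTIVE INTACT dominoes of `u`. -/
def act (c : ℕ) (u : Fin n → Bool) : Finset (Fin (3 * K)) :=
  univ.filter fun j => Intact h hhi u j ∧ phase h c u j % 3 ≠ 1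

include hlo hsep in
/-- the dominoes of a clean triple are intact. -/
theorem intact_of_clean {u : Fin n → Bool} {t' : Fin K} (hc : Clean h u t') (j : Fin (3 * K))
    (hj1 : 3 * t'.val ≤ j.val) (hj2 : j.val ≤ 3 * t'.val + 2) : Intact h hhi u j := by
  have hl := hlo j
  have h0j : h (idx0 t') ≤ h j :=
    h_le_of_le h hsep (Fin.le_iff_val_le_val.2 (by rw [idx0_val]; omega))
  have hj2' : h j ≤ h (idx2 t') :=
    h_le_of_le h hsep (Fin.le_iff_val_le_val.2 (by rw [idx2_val]; omega))
  refine ⟨?_, ?_⟩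
  · rw [hc _ (show h (idx0 t') - 1 ≤ h j - 1 by omega) (show h j - 1 ≤ h (idx2 t') by omega)]
    exact ctr_of_succ_eq h _ j (show h j - 1 + 1 = h j by omega)
  · rw [hc _ (show h (idx0 t') - 1 ≤ h j by omega) (show h j ≤ h (idx2 t') by omega)]
    exact ctr_at h hsep _ j rfl

include hlo hhi hsep in
/-- consecutive dominoes of a clean triple have phases differing by one. -/
theorem phase_step_of_clean (c : ℕ) {u : Fin n → Bool} {t' : Fin K} (hc : Clean h u t')
    (j j₁ : Fin (3 * K)) (hj1 : 3 * t'.val ≤ j.val) (hjj₁ : j₁.val = j.val + 1)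
    (hj₁2 : j₁.val ≤ 3 * t'.val + 2) : phase h c u j₁ % 3 = (phase h c u j + 1) % 3 := by
  have h0j : h (idx0 t') ≤ h j :=
    h_le_of_le h hsep (Fin.le_iff_val_le_val.2 (by rw [idx0_val]; omega))
  have hj₁2' : h j₁ ≤ h (idx2 t') :=
    h_le_of_le h hsep (Fin.le_iff_val_le_val.2 (by rw [idx2_val]; omega))
  exact phase_succ_mod h hlo hhi hsep c u j j₁ hjj₁ fun t ht1 ht2 => hc t (by omega) (by omega)

include hlo hhi hsep in
/-- the phases of a clean triple are `P, P + 1, P + 2`. -/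
theorem phase_offset_of_clean (c : ℕ) {u : Fin n → Bool} {t' : Fin K} (hc : Clean h u t')
    (r : ℕ) (hr : r ≤ 2) :
    phase h c u (idxN t' r hr) % 3 = (phase h c u (idx0 t') + r) % 3 := by
  have e0 := idx0_val t'
  have e1 := idxN_val t' 1 (by omega)
  have e2 := idx2_val t'
  have h1 : phase h c u (idxN t' 1 (by omega)) % 3 = (phase h c u (idx0 t') + 1) % 3 :=
    phase_step_of_clean h hlo hhi hsep c hc _ _ (by omega) (by omega) (by omega)
  have h2 : phase h c u (idx2 t') % 3 = (phase h c u (idxN t' 1 (by omega)) + 1) % 3 :=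
    phase_step_of_clean h hlo hhi hsep c hc _ _ (by omega) (by omega) (by omega)
  interval_cases r
  · rfl
  · exact h1
  · have e : idxN t' 2 hr = idx2 t' := rfl
    rw [e, h2]
    omega

/-- which two dominoes of a triple with first phase `P (mod 3)` are active (offsets within the triple). -/
def poff (P : ℕ) (s : Fin 2) : ℕ :=
  if P = 0 then (if s.val = 0 then 0 else 2) else if P = 1 then (if s.val = 0 then 1 else 2) else s.val

/-- offsets stay in the triple. -/
theorem poff_le (P : ℕ) (s : Fin 2) : poff P s ≤ 2 := by
  unfold poff; have := s.isLt; split_ifs <;> omega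

/-- the two offsets differ. -/
theorem poff_inj (P : ℕ) {s s' : Fin 2} (hs : poff P s = poff P s') : s = s' := by
  apply Fin.ext
  unfold poff at hs
  have := s.isLt; have := s'.isLt
  split_ifs at hs <;> omega

/-- the chosen dominoes are active. -/
theorem poff_active (P : ℕ) (hP : P < 3) (s : Fin 2) : (P + poff P s) % 3 ≠ 1 := by
  unfold poff; have := s.isLt; split_ifs <;> omega

/-- the two chosen active dominoes of a triple. -/
def pick (c : ℕ) (u : Fin n → Bool) (q : Fin K × Fin 2) : Fin (3 * K) :=
  idxN q.1 (poff (phase h c u (idx0 q.1) % 3) q.2) (poff_le _ _)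

/-- the index of a chosen domino. -/
theorem pick_val (c : ℕ) (u : Fin n → Bool) (q : Fin K × Fin 2) :
    (pick h c u q).val = 3 * q.1.val + poff (phase h c u (idx0 q.1) % 3) q.2 := rfl

include hlo hhi hsep in
/-- the chosen dominoes of a clean triple are active and intact. -/
theorem pick_mem_act (c : ℕ) {u : Fin n → Bool} (q : Fin K × Fin 2) (hc : Clean h u q.1) :
    pick h c u q ∈ act h hhi c u := by
  have hpo := poff_le (phase h c u (idx0 q.1) % 3) q.2
  unfold act
  rw [Finset.mem_filter]
  refine ⟨mem_univ _, intact_of_clean h hlo hhi hsep hc _ (by unfold pick; rw [idxN_val]; omega)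
    (by unfold pick; rw [idxN_val]; omega), ?_⟩
  unfold pick
  rw [phase_offset_of_clean h hlo hhi hsep c hc]
  have hact := poff_active (phase h c u (idx0 q.1) % 3) (Nat.mod_lt _ (by norm_num)) q.2
  omega

include hlo hhi hsep in
/-- **two active intact dominoes per clean triple.** -/
theorem two_mul_card_clean_le (c : ℕ) (u : Fin n → Bool) :
    2 * (univ.filter fun t' : Fin K => Clean h u t').card ≤ (act h hhi c u).card := by
  have e : ((univ.filter fun t' : Fin K => Clean h u t') ×ˢ (univ : Finset (Fin 2))).card =
      2 * (univ.filter fun t' : Fin K => Clean h u t').card := by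
    rw [Finset.card_product, Finset.card_univ, Fintype.card_fin]; ring
  rw [← e]
  refine Finset.card_le_card_of_injOn (pick h c u) (fun q hq => ?_) ?_
  · rw [Finset.mem_coe, Finset.mem_product, Finset.mem_filter] at hq
    exact pick_mem_act h hlo hhi hsep c q hq.1.2
  · rintro ⟨q1, q2⟩ _ ⟨q1', q2'⟩ _ hqq
    have hv := congrArg Fin.val hqq
    rw [pick_val, pick_val] at hv
    dsimp only at hv
    have hp1 := poff_le (phase h c u (idx0 q1) % 3) q2
    have hp2 := poff_le (phase h c u (idx0 q1') % 3) q2'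
    have h1 : q1 = q1' := Fin.ext (by omega)
    subst h1
    have h2 : q2 = q2' := poff_inj (phase h c u (idx0 q1) % 3) (by omega)
    rw [h2]

include hsep in
/-- **few dirty triples**: at most one per position where `u` and the centre differ (spans are disjoint). -/
theorem card_dirty_le (u : Fin n → Bool) :
    (univ.filter fun t' : Fin K => ¬ Clean h u t').card ≤ (univ.filter fun t : Fin n => u t ≠ ctr h t).card := by
  have hex : ∀ t' : Fin K, ¬ Clean h u t' →
      ∃ t : Fin n, (h (idx0 t') - 1 ≤ t.val ∧ t.val ≤ h (idx2 t')) ∧ u t ≠ ctr h t := by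
    intro t' hn
    unfold Clean at hn
    push Not at hn
    obtain ⟨t, h1, h2, h3⟩ := hn
    exact ⟨t, ⟨h1, h2⟩, h3⟩
  let φ : Fin K → ℕ := fun t' => if hd : ¬ Clean h u t' then (Classical.choose (hex t' hd)).val else 0
  calc (univ.filter fun t' : Fin K => ¬ Clean h u t').card
      ≤ ((univ.filter fun t : Fin n => u t ≠ ctr h t).image Fin.val).card := by
        refine Finset.card_le_card_of_injOn φ (fun t' ht' => ?_) (fun t₁ ht₁ t₂ ht₂ heq => ?_)
        · rw [Finset.mem_coe, Finset.mem_filter] at ht'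
          have hd := ht'.2
          rw [Finset.mem_coe, Finset.mem_image]
          refine ⟨Classical.choose (hex t' hd), ?_, ?_⟩
          · rw [Finset.mem_filter]
            exact ⟨mem_univ _, (Classical.choose_spec (hex t' hd)).2⟩
          · simp only [φ, dif_pos hd]
        · rw [Finset.mem_coe, Finset.mem_filter] at ht₁ ht₂
          have hd₁ := ht₁.2
          have hd₂ := ht₂.2
          obtain ⟨hs₁a, hs₁b⟩ := (Classical.choose_spec (hex t₁ hd₁)).1
          obtain ⟨hs₂a, hs₂b⟩ := (Classical.choose_spec (hex t₂ hd₂)).1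
          simp only [φ, dif_pos hd₁, dif_pos hd₂] at heq
          by_contra hne
          rcases lt_or_gt_of_ne hne with hlt | hgt
          · have hi : idx2 t₁ < idx0 t₂ :=
              Fin.lt_def.2 (by rw [idx2_val, idx0_val]; have := Fin.lt_def.1 hlt; omega)
            have := hsep _ _ hi
            omega
          · have hi : idx2 t₂ < idx0 t₁ :=
              Fin.lt_def.2 (by rw [idx2_val, idx0_val]; have := Fin.lt_def.1 hgt; omega)
            have := hsep _ _ hi
            omega
    _ ≤ (univ.filter fun t : Fin n => u t ≠ ctr h t).card := Finset.card_image_le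

include hlo hhi hsep in
/-- **THE DOMINO LAW.**  Over a field with `2 ≠ 0`: if the fixed firing set `Y` fires `3K ≥ 6D + 3` cuts
`h_0 < h_1 < ⋯` in `[1, n − 1]`, pairwise `≥ 3` apart, then `Y` wins at every point of `{f ≠ 0}` for NO non-zero `f` of
degree `≤ D`.  (Ball lemma at the designed centre → a point `u ∈ {f ≠ 0}` within distance `D` of the centre → `≥ K − D`
clean triples → `≥ 2D + 1` active intact dominoes of `u` → the domino slice law on their cube through `u` → `f u = 0`.) -/
theorem domino_law {F : Type*} [Field F] (h2 : (2 : F) ≠ 0) {D : ℕ} (hK : 2 * D + 1 ≤ K) (c : ℕ)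
    (Y : Finset (Fin (n + 1))) (hY : ∀ j, (⟨h j, by have := hhi j; omega⟩ : Fin (n + 1)) ∈ Y)
    {f : CubeFn F n} (hf : f ∈ lowDeg F n D) (hwin : ∀ u, f u ≠ 0 → winY c Y u = true) : f = 0 := by
  by_contra hne
  obtain ⟨u, hdist, hu⟩ := exists_near_ne_zero hf hne (ctr h)
  -- enough active intact dominoes
  have hsplit := Finset.card_filter_add_card_filter_not (s := (univ : Finset (Fin K))) (fun t' => Clean h u t')
  rw [Finset.card_univ, Fintype.card_fin] at hsplit
  have hcl := two_mul_card_clean_le h hlo hhi hsep c u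
  have hdi := card_dirty_le h hsep u
  have hAct : 2 * D + 1 ≤ (act h hhi c u).card := by omega
  obtain ⟨A', hA'sub, hA'card⟩ := Finset.exists_subset_card_eq hAct
  obtain ⟨emb, hembmem, hembmono⟩ : ∃ e : Fin (2 * D + 1) → Fin (3 * K), (∀ i, e i ∈ A') ∧ StrictMono e :=
    ⟨A'.orderEmbOfFin hA'card, Finset.orderEmbOfFin_mem A' hA'card, (A'.orderEmbOfFin hA'card).strictMono⟩
  have hmem : ∀ i, Intact h hhi u (emb i) ∧ phase h c u (emb i) % 3 ≠ 1 := fun i => by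
    have hm := hA'sub (hembmem i)
    unfold act at hm
    rw [Finset.mem_filter] at hm
    exact hm.2
  -- the domino family of `u`
  obtain ⟨a, ha⟩ : ∃ a : Fin (2 * D + 1) → ℕ, ∀ i, a i = h (emb i) - 1 := ⟨fun i => h (emb i) - 1, fun _ => rfl⟩
  have hsepA : ∀ i i' : Fin (2 * D + 1), i < i' → a i + 2 ≤ a i' := by
    intro i i' hii
    have hlt : emb i < emb i' := hembmono hii
    have := hsep _ _ hlt
    have := hlo (emb i)
    rw [ha i, ha i']
    omega
  have hbdA : ∀ i, a i + 2 ≤ n := fun i => by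
    have := hhi (emb i); have := hlo (emb i); rw [ha i]; omega
  have hint : ∀ i, u ⟨a i + 1, by have := hbdA i; omega⟩ = !u ⟨a i, by have := hbdA i; omega⟩ := by
    intro i
    obtain ⟨hi1, hi2⟩ := (hmem i).1
    have e1 : (⟨a i + 1, by have := hbdA i; omega⟩ : Fin n) = ⟨h (emb i), by have := hhi (emb i); omega⟩ :=
      Fin.ext (by show a i + 1 = h (emb i); have := hlo (emb i); rw [ha i]; omega)
    have e2 : (⟨a i, by have := hbdA i; omega⟩ : Fin n) = ⟨h (emb i) - 1, by have := hhi (emb i); omega⟩ :=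
      Fin.ext (ha i)
    rw [e1, hi2, e2, hi1]
    rfl
  have hYA : ∀ i, midCut a hbdA i ∈ Y := by
    intro i
    have e : midCut a hbdA i = ⟨h (emb i), by have := hhi (emb i); omega⟩ :=
      Fin.ext (by show a i + 1 = h (emb i); have := hlo (emb i); rw [ha i]; omega)
    rw [e]
    exact hY _
  have hactA : ∀ i, (c + a i + 1 + walkExp (dom a u fun _ => false) (a i)) % 3 ≠ 1 := by
    intro i
    rw [walkExp_dom_orient a hsepA hbdA u hint (fun _ => false) (fun i' => pos_succ_ne a hsepA i' i)]
    have hp := (hmem i).2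
    unfold phase at hp
    have := hlo (emb i)
    rw [ha i]
    have e : c + (h (emb i) - 1) + 1 = c + h (emb i) := by omega
    rw [e]
    exact hp
  have hslice := domino_slice h2 (le_refl _) a hsepA hbdA c Y u hYA hactA hf hwin
  have h0 := hslice (fun i => u ⟨a i, by have := hbdA i; omega⟩)
  rw [dom_self a hsepA hbdA u hint] at h0
  exact hu h0

include hlo hhi hsep in
/-- **Corollary (perfect feature level sets vanish under dense firing).**  A perfect strategy that fires the constant set
`Y` on the level set `{P = 1}` of `𝔽_p`-degree `≤ D` (`p` odd), where `Y` contains `3K ≥ 6D + 3` cuts of `[1, n − 1]`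
pairwise `≥ 3` apart: the level set is empty. -/
theorem levelSet_empty_of_dense (p : ℕ) [Fact p.Prime] (hp2 : p ≠ 2) {D : ℕ} (hK : 2 * D + 1 ≤ K) (c : ℕ)
    (y : Fin (n + 1) → (Fin n → Bool) → Bool) (P : (Fin n → Bool) → Bool) (hP : HasDegF p P D)
    (Y : Finset (Fin (n + 1))) (hY : ∀ j, (⟨h j, by have := hhi j; omega⟩ : Fin (n + 1)) ∈ Y)
    (hfire : ∀ v, P v = true → ∀ g, (y g v = true ↔ g ∈ Y)) (hperf : ∀ v, P v = true → ringWinU c y v = true) :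
    ∀ v, P v = false := by
  have h2 : (2 : ZMod p) ≠ 0 := by
    intro h0
    have h' : ((2 : ℕ) : ZMod p) = 0 := by exact_mod_cast h0
    rw [ZMod.natCast_eq_zero_iff] at h'
    exact hp2 ((Nat.prime_dvd_prime_iff_eq (Fact.out) Nat.prime_two).1 h')
  have hwin : ∀ v, (fun x => if P x = true then (1 : ZMod p) else 0) v ≠ 0 → winY c Y v = true := by
    intro v hv
    have hPv : P v = true := by
      by_contra hc
      exact hv (by simp [hc])
    rw [← ringWinU_eq_winY c y Y v (hfire v hPv)]
    exact hperf v hPv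
  have hzero := domino_law h hlo hhi hsep h2 hK c Y hY hP hwin
  intro v
  have h0 := congr_fun hzero v
  by_contra hc
  rw [Bool.not_eq_false] at hc
  simp [hc] at h0

end FullLaw

end

end Summit.QuantumAdvantage.QuantumAdvantage.Theorems.DominoLaw
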